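import Literature.Geometry.Lorentzian.KerrConvergence
import HarnessLib

/-!
# Pointed `Cᵏ_loc` (Cheeger–Gromov) subconvergence of spacetimes, with eternal far charts
(topic `Geometry/Lorentzian`; definition item `defn-SpacetimeLocalConvergence`, wanted by the
crux `LaSalleTransfer` of route `FinalStateConjecture/EternalPapapetrou`, to split it into
compactness / limit-structure / assembly children)

## The notion

Cheeger–Gromov convergence of pointed Riemannian manifolds (Petersen, *Riemannian Geometry*,
2nd ed., Ch. 10, §3.2; Anderson, *Cheeger–Gromov theory and applications to general relativity*
(2004), Def. 1.1): `(Mᵢ, pᵢ, gᵢ) → (M, p, g)` in the pointed `C^{m,α}` (here: `Cᵏ`) topology if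
for every `R > 0` there are a domain `Ω ⊇ B(p, R)` of the LIMIT and embeddings `Fᵢ : Ω → Mᵢ` for
large `i` with `Fᵢ^* gᵢ → g` on `Ω`, convergence of tensors on a precompact set meaning
convergence of their COMPONENTS IN CHARTS of `M` (Petersen, loc. cit.: "in the charts for some
fixed finite covering of coordinate patches; clearly independent of the covering"; Anderson,
Def. 1.1: `(Fᵢ^* gᵢ)_{αβ} → g_{αβ}` in a locally finite collection of charts, "uniform on compact
subsets"). We vendor this for time-oriented Lorentzian `4`-manifolds (`Spacetime 4` of
`LorentzianMetric.lean`), along a SUBSEQUENCE, as the planner requested: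

* `Spacetime.LocalSubconvergence 𝓢ₙ pₙ 𝓢 p k` — the DATA of a pointed `Cᵏ_loc` subconvergence of
  the pointed spacetimes `(𝓢ₙ n, pₙ n)` to `(𝓢, p)`: a strictly increasing `sub : ℕ → ℕ`; an
  exhaustion `U 0 ⊆ U 1 ⊆ ⋯` of `𝓢` by precompact open sets with `p ∈ U 0`; comparison maps
  `embed n : 𝓢 → 𝓢ₙ (sub n)` which are injective `C^∞` local diffeomorphisms ON `U n` (hence open
  embeddings of `U n`; Mathlib `IsLocalDiffeomorphOn`, `Set.InjOn`; total maps, junk off `U n`),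
  send `p` to `pₙ (sub n)` and preserve the time orientations on `U n`; and `Cᵏ` convergence
  `embed n ^* g_{sub n} → g`: for every point `x` of the limit and every compact `K` inside the
  target of the preferred chart `chartAt E4 x`, the `Cᵏ` sup norm over `K` (`supCkENorm` of
  `KerrConvergence.lean`: `sup_{m ≤ k} sup_K ‖D^m ·‖`, Mathlib `iteratedFDeriv` on `E4`) of the
  difference of the coordinate components (`Spacetime.metricInCoords`) tends to `0`.
* `Spacetime.SubconvergesLocallyTo 𝓢ₙ pₙ 𝓢 p k : Prop` — `Nonempty` of the above (the requested
  predicate, with the requested signature).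
* `Spacetime.LocalSubconvergence.FarChartsConverge D B Φₙ Φ : Prop` — the COMPANION CLAUSE for
  eternal far charts over a reference background `B : ModelBackground` (`KerrConvergence.lean`;
  the route uses `B = ⟨Kerr.region 0 R, Kerr.bilin M 0, x⁰, Kerr.radius 0⟩`): the far charts
  `Φₙ n : B.domain → 𝓢ₙ n` converge THROUGH the embeddings to the far chart `Φ : B.domain → 𝓢`
  of the limit — eventually on every compact `K ⊆ B.domain`, `embed n ∘ Φ = Φₙ (sub n)` — and the
  deviations `Φₙ^* gₙ − g₀` (`Spacetime.deviationExtend`) converge to `Φ^* g − g₀` in `Cᵏ` on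
  every compact `K ⊆ B.domain`. Uniform bounds such as `‖D^m(Φₙ^* gₙ − g_M)‖ · r ≤ C` are then
  INHERITED by the limit (`FarChartsConverge.norm_iteratedFDeriv_mul_le`, proved).
  `Spacetime.SubconvergesLocallyWithFarChartsTo` bundles both as one `Prop`.

API (all proved): `LocalSubconvergence.refl` / `SubconvergesLocallyTo.refl` (a constant sequence
subconverges to itself: non-vacuity), `.subseq` (stability under passing to a further
subsequence), `.mono` (in `k`), `eventually_subset_U` (a compact set of the limit lies in `U n`
for large `n`), `contMDiffOn_embed`, `FarChartsConverge.tendsto_iteratedFDeriv`.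

## Design choices (for the reviewer)

* **Diagonalised form.** Petersen's data `(R ↦ Ω_R, Fᵢ for i ≥ N(R))` and ours (one exhaustion
  `U n` and one map `embed n` per index of the subsequence) are interchangeable by the usual
  diagonal argument; all per-`n` clauses are imposed for every `n` (a producer discards finitely
  many bad indices by `subseq`). Distance balls `B(p, R)` do not exist on a Lorentzian manifold;
  "domains `Ω ⊇ B(p, R)`" becomes "an exhaustion by precompact open sets containing `p`".
* **No covering clause.** Petersen's `Fᵢ(Ω) ⊇ B(pᵢ, R)` (nothing near the base points is lost
  in the limit) has no Lorentzian analogue without extra structure and is NOT imposed: the limit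
  is asserted to capture what the embeddings see. In the intended use the far-chart clause pins
  the asymptotic region (its domain is the whole eternal cylinder `ℝ × {r > R}`); statements that
  need more (e.g. "the limit is its own domain of outer communications") say so themselves.
* **Honest `Cᵏ` norms.** As in `KerrConvergence.lean`, derivatives are taken on the model space:
  the components of a fibrewise bilinear form in the chart `c = chartAt E4 x` are the pullback
  along `c.symm : E4 → 𝓢` (`pullbackBilin`; at `y ∈ c.target` this is
  `g_{c.symm y}(D(c' ∘ c⁻¹) ·, D(c' ∘ c⁻¹) ·)` with `c'` the preferred chart at `c.symm y`, i.e.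
  the tensor transformation law — a chart-independent scalar), a map `E4 → (E4 →L E4 →L ℝ)` into a
  fixed normed space, and `embed n ^* g_{sub n}` in the same chart is the pullback along
  `embed n ∘ c.symm`. Convergence in the preferred charts on compact subsets of their targets is
  equivalent to `Cᵏ_loc` convergence in any smooth atlas (chain rule on compact sets; not proved
  here). `BoundedGeometry.lean`'s `Spacetime.chartMetric B Ψ` is the same construction for chart
  maps defined on an open `B.domain ⊆ E4`; here the chart maps are total on `E4`.
* **Strength.** This is deliberately the STRONG (smooth Cheeger–Gromov) notion: `Cᵏ` convergence
  of components for the `k` of the statement, time orientations preserved, basepoints matched.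
  It excludes the weak (Burnett / high-frequency, arXiv:1907.10743) limits under which vacuum can
  leave vacuum — that exclusion is the point of the crux it serves.
* Mathlib has no convergence of Riemannian or Lorentzian manifolds
  (`lean search 'CheegerGromov|GromovHausdorff.*[Mm]anifold|pointedConvergence'`: only
  `Mathlib.Topology.MetricSpace.GromovHausdorff` for compact metric spaces). Nothing here
  duplicates an existing declaration (`Spacetime.chartMetric`, `LorentzianMetric.coordMetric` are
  different objects, see above).

## References

* [Petersen2006] P. Petersen, *Riemannian Geometry*, 2nd ed., GTM 171, Springer 2006, Ch. 10
  (Convergence), §3.2 "Convergence of Riemannian manifolds" (pointed `C^{m,α}` convergence;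
  3rd ed. 2016, Ch. 11), Thm. 72.
* [Anderson2004] M. T. Anderson, *Cheeger–Gromov theory and applications to general relativity*,
  in: The Einstein equations and the large scale behavior of gravitational fields, Birkhäuser
  2004, 347–377 = arXiv:gr-qc/0208079: Def. 1.1 (convergence of metrics modulo diffeomorphisms,
  componentwise in charts), §1 (pointed blow-up limits), §5 (Lorentzian analogues: sizes measured
  after fixing a timelike direction / time function).
* [arXiv210408222] M. Dafermos, G. Holzegel, I. Rodnianski, M. Taylor, arXiv:2104.08222, §1
  (`Cᵏ` sup norms of metric deviations, as vendored in `KerrConvergence.lean`).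
-/

noncomputable section

open TopologicalSpace Manifold Filter Topology Set Function
open scoped ContDiff Topology ENNReal

universe u v

namespace Literature.Geometry.Lorentzian

namespace Spacetime

/-! ### Components of (pulled-back) metrics in a chart of the model space -/

section MetricInCoords

variable (𝓢 : Spacetime.{u} 4)

/-- The **components of the pulled-back metric `ψ^* g` on the model space**: for a map
`ψ : E4 → 𝓢.carrier` (a chart inverse `(chartAt E4 x).symm`, or a comparison map composed with
it; total on `E4`, only its values where `ψ` is a smooth parametrisation are meaningful) and
`y ∈ E4`, the continuous bilinear form `(v, w) ↦ g_{ψ y}(dψ_y v, dψ_y w)` on `E4`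
(`pullbackBilin`, O'Neill 1983, Def. 3.9), viewed in the normed space `E4 →L[ℝ] E4 →L[ℝ] ℝ` so
that Mathlib's `iteratedFDeriv ℝ m` applies. For `ψ = (chartAt E4 x).symm` and `y` in the chart
target these are the components `g_{αβ}(y)` of `g` in that chart (Anderson 2004, Def. 1.1;
Petersen 2006, Ch. 10, §3.2). [cite: Anderson2004, Def. 1.1] -/
def metricInCoords (ψ : E4 → 𝓢.carrier) (y : E4) : E4 →L[ℝ] E4 →L[ℝ] ℝ :=
  show E4 →L[ℝ] E4 →L[ℝ] ℝ from pullbackBilin (I := 𝓡 4) (I' := 𝓘(ℝ, E4)) ψ 𝓢.metric.val y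

/-- Unfolding lemma: `metricInCoords 𝓢 ψ y v w = g_{ψ y}(dψ_y v, dψ_y w)`. [folklore] -/
theorem metricInCoords_apply (ψ : E4 → 𝓢.carrier) (y v w : E4) :
    𝓢.metricInCoords ψ y v w =
      𝓢.metric.val (ψ y) (mfderiv 𝓘(ℝ, E4) (𝓡 4) ψ y v) (mfderiv 𝓘(ℝ, E4) (𝓡 4) ψ y w) :=
  rfl

/-- The components are symmetric (the spacetime metric is). [folklore] -/
theorem metricInCoords_symm (ψ : E4 → 𝓢.carrier) (y v w : E4) :
    𝓢.metricInCoords ψ y v w = 𝓢.metricInCoords ψ y w v := by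
  rw [metricInCoords_apply, metricInCoords_apply, 𝓢.metric.symm]

end MetricInCoords

/-! ### Pointed `Cᵏ_loc` subconvergence: the data -/

/-- **Data of a pointed `Cᵏ_loc` (Cheeger–Gromov) subconvergence** of the pointed spacetimes
`(𝓢ₙ n, pₙ n)` to the pointed spacetime `(𝓢, p)` (Petersen 2006, Ch. 10, §3.2, pointed
`C^{m,α}` convergence, in diagonalised form; Anderson 2004, Def. 1.1; see the module docstring):
a subsequence `sub`; an exhaustion `U` of the limit by precompact open sets, increasing, with
`p ∈ U 0`; comparison maps `embed n : 𝓢.carrier → (𝓢ₙ (sub n)).carrier` (total; meaningful on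
`U n`) which are injective `C^∞` local diffeomorphisms on `U n`, map `p ↦ pₙ (sub n)` and preserve
the time orientations on `U n`; and `Cᵏ` convergence of the components of `embed n ^* g_{sub n}`
to those of `g` on every compact subset of the target of every preferred chart `chartAt E4 x` of
the limit (`supCkENorm`, `metricInCoords`). No covering clause `Fᵢ(Ω) ⊇ B(pᵢ, R)` (module
docstring). [cite: Petersen2006, Ch. 10 §3.2] -/
structure LocalSubconvergence (𝓢ₙ : ℕ → Spacetime.{u} 4) (pₙ : ∀ n, (𝓢ₙ n).carrier)
    (𝓢 : Spacetime.{v} 4) (p : 𝓢.carrier) (k : ℕ) where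
  /-- The subsequence `n ↦ sub n` along which convergence takes place. -/
  sub : ℕ → ℕ
  /-- The subsequence is strictly increasing. -/
  strictMono_sub : StrictMono sub
  /-- The exhaustion `U 0 ⊆ U 1 ⊆ ⋯` of the limit by precompact open sets. -/
  U : ℕ → Opens 𝓢.carrier
  /-- The exhaustion is increasing. -/
  monotone_U : Monotone U
  /-- The base point of the limit lies in the first set. -/
  mem_U : p ∈ U 0
  /-- The sets `U n` cover the limit. -/
  iUnion_U : ⋃ n, (U n : Set 𝓢.carrier) = univ
  /-- Each `U n` is precompact. -/
  isCompact_closure_U : ∀ n, IsCompact (closure (U n : Set 𝓢.carrier))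
  /-- The comparison maps `φₙ : 𝓢 → 𝓢_{sub n}` (total functions; meaningful on `U n` only). -/
  embed : ∀ n, 𝓢.carrier → (𝓢ₙ (sub n)).carrier
  /-- `φₙ` is a `C^∞` local diffeomorphism at every point of `U n`. -/
  isLocalDiffeomorphOn_embed : ∀ n, IsLocalDiffeomorphOn (𝓡 4) (𝓡 4) ∞ (embed n) (U n)
  /-- `φₙ` is injective on `U n` (so `φₙ|U n` is an open embedding). -/
  injOn_embed : ∀ n, InjOn (embed n) (U n)
  /-- `φₙ` maps the base point to the base point. -/
  embed_basepoint : ∀ n, embed n p = pₙ (sub n)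
  /-- `φₙ` preserves the time orientations on `U n`: `dφₙ` sends the orienting vector field of
  the limit to future-directed vectors. -/
  isFutureDirected_mfderiv_embed : ∀ n, ∀ x ∈ U n,
    (𝓢ₙ (sub n)).timeOrientation.IsFutureDirected
      (mfderiv (𝓡 4) (𝓡 4) (embed n) x (𝓢.timeOrientation.vectorField x))
  /-- `φₙ^* g_{sub n} → g` in `Cᵏ` on every compact subset of (the target of) every preferred
  chart of the limit. -/
  tendsto_supCkENorm : ∀ (x : 𝓢.carrier) (K : Set E4), IsCompact K →
    K ⊆ (chartAt E4 x).target →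
      Tendsto (fun n ↦ supCkENorm K k
        ((𝓢ₙ (sub n)).metricInCoords (embed n ∘ (chartAt E4 x).symm) -
          𝓢.metricInCoords (chartAt E4 x).symm)) atTop (𝓝 0)

/-- **Pointed `Cᵏ_loc` subconvergence** `(𝓢ₙ n, pₙ n) ⇀ (𝓢, p)`: some subsequence of the pointed
spacetimes converges to `(𝓢, p)` in the pointed `Cᵏ` (Cheeger–Gromov) sense, i.e. there is a
`LocalSubconvergence` datum. Petersen 2006, Ch. 10, §3.2; Anderson 2004, Def. 1.1.
[cite: Petersen2006, Ch. 10 §3.2] -/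
def SubconvergesLocallyTo (𝓢ₙ : ℕ → Spacetime.{u} 4) (pₙ : ∀ n, (𝓢ₙ n).carrier)
    (𝓢 : Spacetime.{v} 4) (p : 𝓢.carrier) (k : ℕ) : Prop :=
  Nonempty (LocalSubconvergence 𝓢ₙ pₙ 𝓢 p k)

namespace LocalSubconvergence

variable {𝓢ₙ : ℕ → Spacetime.{u} 4} {pₙ : ∀ n, (𝓢ₙ n).carrier} {𝓢 : Spacetime.{v} 4}
  {p : 𝓢.carrier} {k : ℕ}

/-- The **deviation in the chart at `x`** along the `n`-th comparison map: components of
`φₙ^* g_{sub n}` minus components of `g` in `chartAt E4 x` (the quantity whose `Cᵏ` sup norms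
tend to `0`, `tendsto_supCkENorm_coordDeviation`). Anderson 2004, Def. 1.1. [folklore] -/
def coordDeviation (D : LocalSubconvergence 𝓢ₙ pₙ 𝓢 p k) (n : ℕ) (x : 𝓢.carrier) :
    E4 → E4 →L[ℝ] E4 →L[ℝ] ℝ :=
  (𝓢ₙ (D.sub n)).metricInCoords (D.embed n ∘ (chartAt E4 x).symm) -
    𝓢.metricInCoords (chartAt E4 x).symm

/-- The convergence clause, restated with `coordDeviation`. [folklore] -/
theorem tendsto_supCkENorm_coordDeviation (D : LocalSubconvergence 𝓢ₙ pₙ 𝓢 p k)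
    (x : 𝓢.carrier) {K : Set E4} (hK : IsCompact K) (hKt : K ⊆ (chartAt E4 x).target) :
    Tendsto (fun n ↦ supCkENorm K k (D.coordDeviation n x)) atTop (𝓝 0) :=
  D.tendsto_supCkENorm x K hK hKt

/-- The comparison maps are `C^∞` on `U n` (a local diffeomorphism is smooth). [folklore] -/
theorem contMDiffOn_embed (D : LocalSubconvergence 𝓢ₙ pₙ 𝓢 p k) (n : ℕ) :
    ContMDiffOn (𝓡 4) (𝓡 4) ∞ (D.embed n) (D.U n) :=
  (D.isLocalDiffeomorphOn_embed n).contMDiffOn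

/-- The comparison maps are continuous on `U n`. [folklore] -/
theorem continuousOn_embed (D : LocalSubconvergence 𝓢ₙ pₙ 𝓢 p k) (n : ℕ) :
    ContinuousOn (D.embed n) (D.U n) :=
  (D.contMDiffOn_embed n).continuousOn

/-- The base point lies in every `U n`. [folklore] -/
theorem basepoint_mem_U (D : LocalSubconvergence 𝓢ₙ pₙ 𝓢 p k) (n : ℕ) : p ∈ D.U n :=
  D.monotone_U (Nat.zero_le n) D.mem_U

/-- `φₙ` restricted to the open set `U n` is an open topological embedding (an injective local
homeomorphism; cf. the late-time charts `IsLateChart` of `KerrConvergence.lean`). Petersen 2006,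
Ch. 10, §3.2 ("embeddings `Fᵢ : Ω → Mᵢ`"). [folklore] -/
theorem isOpenEmbedding_restrict_embed (D : LocalSubconvergence 𝓢ₙ pₙ 𝓢 p k) (n : ℕ) :
    IsOpenEmbedding ((D.U n : Set 𝓢.carrier).restrict (D.embed n)) := by
  have hval : IsLocalHomeomorph (Subtype.val : ↥(D.U n : Set 𝓢.carrier) → 𝓢.carrier) :=
    (D.U n).isOpen.isOpenEmbedding_subtypeVal.isLocalHomeomorph
  have hcomp : IsLocalHomeomorphOn
      (D.embed n ∘ (Subtype.val : ↥(D.U n : Set 𝓢.carrier) → 𝓢.carrier)) univ :=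
    (D.isLocalDiffeomorphOn_embed n).isLocalHomeomorphOn.comp hval.isLocalHomeomorphOn
      fun x _ ↦ x.2
  exact (isLocalHomeomorph_iff_isLocalHomeomorphOn_univ.2 hcomp).isOpenEmbedding_of_injective
    (injOn_iff_injective.1 (D.injOn_embed n))

/-- **Exhaustion lemma**: a compact subset of the limit lies in `U n` for all large `n`
(increasing open cover and compactness). Petersen 2006, Ch. 10, §3.2 (every `B(p, R)` lies in
some `Ω`). [folklore] -/
theorem eventually_subset_U (D : LocalSubconvergence 𝓢ₙ pₙ 𝓢 p k) {K : Set 𝓢.carrier}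
    (hK : IsCompact K) : ∀ᶠ n in atTop, K ⊆ D.U n := by
  have hmono : Monotone fun n ↦ (D.U n : Set 𝓢.carrier) := fun _ _ h ↦ D.monotone_U h
  obtain ⟨i, hi⟩ := hK.elim_directed_cover (fun n ↦ (D.U n : Set 𝓢.carrier))
    (fun n ↦ (D.U n).isOpen) (D.iUnion_U.symm ▸ subset_univ K)
    (fun m n ↦ ⟨max m n, hmono (le_max_left m n), hmono (le_max_right m n)⟩)
  exact eventually_atTop.2 ⟨i, fun n hn ↦ hi.trans (hmono hn)⟩

/-- Every point of the limit lies in `U n` for all large `n`. [folklore] -/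
theorem eventually_mem_U (D : LocalSubconvergence 𝓢ₙ pₙ 𝓢 p k) (x : 𝓢.carrier) :
    ∀ᶠ n in atTop, x ∈ D.U n :=
  (D.eventually_subset_U isCompact_singleton).mono fun _ h ↦ h (mem_singleton x)

/-- `Cᵏ` subconvergence implies `Cᵏ'` subconvergence for `k' ≤ k`, with the same data
(`supCkENorm` is monotone in the order). [folklore] -/
def mono (D : LocalSubconvergence 𝓢ₙ pₙ 𝓢 p k) {k' : ℕ} (hk : k' ≤ k) :
    LocalSubconvergence 𝓢ₙ pₙ 𝓢 p k' where
  sub := D.sub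
  strictMono_sub := D.strictMono_sub
  U := D.U
  monotone_U := D.monotone_U
  mem_U := D.mem_U
  iUnion_U := D.iUnion_U
  isCompact_closure_U := D.isCompact_closure_U
  embed := D.embed
  isLocalDiffeomorphOn_embed := D.isLocalDiffeomorphOn_embed
  injOn_embed := D.injOn_embed
  embed_basepoint := D.embed_basepoint
  isFutureDirected_mfderiv_embed := D.isFutureDirected_mfderiv_embed
  tendsto_supCkENorm x K hK hKt :=
    tendsto_of_tendsto_of_tendsto_of_le_of_le tendsto_const_nhds (D.tendsto_supCkENorm x K hK hKt)
      (fun _ ↦ zero_le) fun _ ↦ supCkENorm_mono_right _ hk _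

/-- **Stability under subsequences**: composing the data with a strictly increasing `ρ : ℕ → ℕ`
(the exhaustion `U ∘ ρ` still covers since `n ≤ ρ n`). Used for diagonal arguments.
[folklore] -/
def subseq (D : LocalSubconvergence 𝓢ₙ pₙ 𝓢 p k) (ρ : ℕ → ℕ) (hρ : StrictMono ρ) :
    LocalSubconvergence 𝓢ₙ pₙ 𝓢 p k where
  sub := D.sub ∘ ρ
  strictMono_sub := D.strictMono_sub.comp hρ
  U := D.U ∘ ρ
  monotone_U := D.monotone_U.comp hρ.monotone
  mem_U := D.monotone_U (Nat.zero_le _) D.mem_U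
  iUnion_U := by
    refine eq_univ_of_forall fun x ↦ ?_
    have hx : x ∈ ⋃ n, (D.U n : Set 𝓢.carrier) := D.iUnion_U.symm ▸ mem_univ x
    obtain ⟨n, hn⟩ := mem_iUnion.1 hx
    exact mem_iUnion.2 ⟨n, D.monotone_U hρ.le_apply hn⟩
  isCompact_closure_U n := D.isCompact_closure_U (ρ n)
  embed n := D.embed (ρ n)
  isLocalDiffeomorphOn_embed n := D.isLocalDiffeomorphOn_embed (ρ n)
  injOn_embed n := D.injOn_embed (ρ n)
  embed_basepoint n := D.embed_basepoint (ρ n)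
  isFutureDirected_mfderiv_embed n := D.isFutureDirected_mfderiv_embed (ρ n)
  tendsto_supCkENorm x K hK hKt := (D.tendsto_supCkENorm x K hK hKt).comp hρ.tendsto_atTop

/-! ### The constant sequence subconverges (non-vacuity) -/

section Refl

variable (𝓢 : Spacetime.{u} 4) (p : 𝓢.carrier)

/-- A compact exhaustion of the carrier of a spacetime (a second countable manifold modelled on
`E4` is locally compact and σ-compact; Mathlib's `CompactExhaustion.choice`). [folklore] -/
def compactExhaustion : CompactExhaustion 𝓢.carrier :=
  haveI : LocallyCompactSpace 𝓢.carrier := ChartedSpace.locallyCompactSpace E4 𝓢.carrier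
  CompactExhaustion.choice 𝓢.carrier

/-- The precompact open exhaustion used by `refl`: interiors of the compact exhaustion, shifted
so that the base point lies in the first set. [folklore] -/
def reflOpens (n : ℕ) : Opens 𝓢.carrier :=
  ⟨interior (compactExhaustion 𝓢 (n + ((compactExhaustion 𝓢).find p + 1))), isOpen_interior⟩

/-- Membership in `reflOpens`. [folklore] -/
@[simp]
theorem mem_reflOpens {n : ℕ} {x : 𝓢.carrier} :
    x ∈ reflOpens 𝓢 p n ↔
      x ∈ interior (compactExhaustion 𝓢 (n + ((compactExhaustion 𝓢).find p + 1)) :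
        Set 𝓢.carrier) :=
  Iff.rfl

/-- **The constant sequence `(𝓢, p)` subconverges to `(𝓢, p)`** in `Cᵏ` for every `k`, with
`sub = id`, the comparison maps the identity and any precompact open exhaustion: the data
(Petersen 2006, Ch. 10, §3.2 — a constant sequence converges). Non-vacuity of
`LocalSubconvergence`. [folklore] -/
def refl (k : ℕ) : LocalSubconvergence (fun _ ↦ 𝓢) (fun _ ↦ p) 𝓢 p k where
  sub := id
  strictMono_sub := strictMono_id
  U := reflOpens 𝓢 p
  monotone_U _ _ hmn _ hx :=
    interior_mono ((compactExhaustion 𝓢).subset (Nat.add_le_add_right hmn _)) hx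
  mem_U := (compactExhaustion 𝓢).subset_interior (by omega) ((compactExhaustion 𝓢).mem_find p)
  iUnion_U := eq_univ_of_forall fun x ↦ mem_iUnion.2
    ⟨(compactExhaustion 𝓢).find x + 1,
      (compactExhaustion 𝓢).subset_interior (by omega) ((compactExhaustion 𝓢).mem_find x)⟩
  isCompact_closure_U _ := ((compactExhaustion 𝓢).isCompact _).closure_of_subset interior_subset
  embed _ := id
  isLocalDiffeomorphOn_embed _ := by
    have h := (Diffeomorph.refl (𝓡 4) 𝓢.carrier ∞).isLocalDiffeomorph
    rw [Diffeomorph.coe_refl] at h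
    exact h.isLocalDiffeomorphOn _
  injOn_embed _ := injOn_id _
  embed_basepoint _ := rfl
  isFutureDirected_mfderiv_embed _ x _ := by
    rw [mfderiv_id]
    exact 𝓢.timeOrientation.isFutureDirected_vectorField x
  tendsto_supCkENorm x K _ _ := by
    -- `id ∘ c.symm = c.symm` definitionally, so the deviation is `f - f = 0` (term-mode
    -- `sub_self`; `simp` does not see through the `Sub` instance of the bilinear-form type)
    have h0 : 𝓢.metricInCoords (id ∘ (chartAt E4 x).symm) - 𝓢.metricInCoords (chartAt E4 x).symm
        = 0 :=
      sub_self (𝓢.metricInCoords (chartAt E4 x).symm)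
    show Tendsto (fun _ : ℕ ↦ supCkENorm K k
      (𝓢.metricInCoords (id ∘ (chartAt E4 x).symm) - 𝓢.metricInCoords (chartAt E4 x).symm))
      atTop (𝓝 0)
    rw [h0, supCkENorm_zero]
    exact tendsto_const_nhds

end Refl

end LocalSubconvergence

/-- **A constant sequence subconverges to itself** (in `Cᵏ` for every `k`). Petersen 2006,
Ch. 10, §3.2. [folklore] -/
theorem SubconvergesLocallyTo.refl (𝓢 : Spacetime.{u} 4) (p : 𝓢.carrier) (k : ℕ) :
    SubconvergesLocallyTo (fun _ ↦ 𝓢) (fun _ ↦ p) 𝓢 p k :=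
  ⟨LocalSubconvergence.refl 𝓢 p k⟩

/-- `Cᵏ` subconvergence implies `Cᵏ'` subconvergence for `k' ≤ k`. [folklore] -/
theorem SubconvergesLocallyTo.mono {𝓢ₙ : ℕ → Spacetime.{u} 4} {pₙ : ∀ n, (𝓢ₙ n).carrier}
    {𝓢 : Spacetime.{v} 4} {p : 𝓢.carrier} {k k' : ℕ} (h : SubconvergesLocallyTo 𝓢ₙ pₙ 𝓢 p k)
    (hk : k' ≤ k) : SubconvergesLocallyTo 𝓢ₙ pₙ 𝓢 p k' :=
  h.elim fun D ↦ ⟨D.mono hk⟩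

/-! ### Companion clause: eternal far charts converge through the embeddings -/

namespace LocalSubconvergence

variable {𝓢ₙ : ℕ → Spacetime.{u} 4} {pₙ : ∀ n, (𝓢ₙ n).carrier} {𝓢 : Spacetime.{v} 4}
  {p : 𝓢.carrier} {k : ℕ}

/-- **Far charts converge along the subconvergence datum `D`.** For a reference background `B`
(`ModelBackground`: domain `B.domain ⊆ E4`, reference form `g₀ = B.bilin`; for the eternal far
zone `B = ⟨Kerr.region 0 R, Kerr.bilin M 0, x⁰, Kerr.radius 0⟩`), far charts
`Φₙ n : B.domain → 𝓢ₙ n` of the members and `Φ : B.domain → 𝓢` of the limit: (i) the comparison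
maps EXTEND the far-chart identification — for every compact `K ⊆ B.domain`, eventually
`embed n (Φ y) = Φₙ (sub n) y` for all `y ∈ K`; (ii) the metric deviations
`hₙ = Φₙ^* gₙ − g₀` (`Spacetime.deviationExtend`) converge along the subsequence to
`h = Φ^* g − g₀` in `Cᵏ` on every compact `K ⊆ B.domain` (`supCkENorm`). Regularity of the far
charts (injective local diffeomorphisms, as in the route items) is NOT part of this clause.
Uniform bounds on `hₙ` pass to `h` (`norm_iteratedFDeriv_mul_le`). Consequence-form `Cᵏ` norms:
DHRT arXiv:2104.08222, §1; convergence in charts: Anderson 2004, Def. 1.1.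
[cite: Anderson2004, Def. 1.1] -/
structure FarChartsConverge (D : LocalSubconvergence 𝓢ₙ pₙ 𝓢 p k) (B : ModelBackground)
    (Φₙ : ∀ n, B.domain → (𝓢ₙ n).carrier) (Φ : B.domain → 𝓢.carrier) : Prop where
  /-- On every compact part of the far zone, eventually `embed n ∘ Φ = Φₙ (sub n)`. -/
  eventually_embed_comp_eq : ∀ K : Set E4, IsCompact K → K ⊆ B.domain →
    ∀ᶠ n in atTop, ∀ y : B.domain, y.1 ∈ K → D.embed n (Φ y) = Φₙ (D.sub n) y
  /-- `Φₙ^* gₙ − g₀ → Φ^* g − g₀` in `Cᵏ` on every compact part of the far zone. -/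
  tendsto_supCkENorm_deviationExtend : ∀ K : Set E4, IsCompact K → K ⊆ B.domain →
    Tendsto (fun n ↦ supCkENorm K k
      ((𝓢ₙ (D.sub n)).deviationExtend B (Φₙ (D.sub n)) - 𝓢.deviationExtend B Φ)) atTop (𝓝 0)

namespace FarChartsConverge

variable {D : LocalSubconvergence 𝓢ₙ pₙ 𝓢 p k} {B : ModelBackground}
  {Φₙ : ∀ n, B.domain → (𝓢ₙ n).carrier} {Φ : B.domain → 𝓢.carrier}

/-- **Pointwise convergence of derivatives of the far deviations**: if `hₙ → h` in `Cᵏ` on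
compacts (clause (ii)), `m ≤ k`, and `h_{sub n}` (eventually) and `h` are `Cᵐ` at a point `x` of
the far zone, then `D^m h_{sub n}(x) → D^m h(x)` (`iteratedFDeriv_sub_apply` and the bound
`‖D^m ·(x)‖ ≤ supCkENorm {x} k ·`). [folklore] -/
theorem tendsto_iteratedFDeriv (h : D.FarChartsConverge B Φₙ Φ) {m : ℕ} (hm : m ≤ k)
    (x : B.domain)
    (hₙ : ∀ᶠ n in atTop, ContDiffAt ℝ m ((𝓢ₙ (D.sub n)).deviationExtend B (Φₙ (D.sub n))) x)
    (hlim : ContDiffAt ℝ m (𝓢.deviationExtend B Φ) x) :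
    Tendsto (fun n ↦ iteratedFDeriv ℝ m ((𝓢ₙ (D.sub n)).deviationExtend B (Φₙ (D.sub n))) x)
      atTop (𝓝 (iteratedFDeriv ℝ m (𝓢.deviationExtend B Φ) x)) := by
  have h0 : Tendsto (fun n ↦ ‖iteratedFDeriv ℝ m
      ((𝓢ₙ (D.sub n)).deviationExtend B (Φₙ (D.sub n)) - 𝓢.deviationExtend B Φ) x‖ₑ)
      atTop (𝓝 0) :=
    tendsto_of_tendsto_of_tendsto_of_le_of_le tendsto_const_nhds
      (h.tendsto_supCkENorm_deviationExtend {x.1} isCompact_singleton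
        (singleton_subset_iff.2 x.2))
      (fun _ ↦ zero_le) fun _ ↦ enorm_iteratedFDeriv_le_supCkENorm hm (mem_singleton _) _
  refine tendsto_iff_enorm_sub_tendsto_zero.2 (h0.congr' ?_)
  filter_upwards [hₙ] with n hn
  rw [iteratedFDeriv_sub_apply hn hlim]

/-- **Inherited bounds**: a bound `‖D^m h_{sub n}(x)‖ · w ≤ C` holding for all large `n`
(e.g. the eternal far-zone bound `‖D^m(Φₙ^* gₙ − g_M)(x)‖ · r(x) ≤ C` of the route) passes to the
limit, `‖D^m h(x)‖ · w ≤ C` (`le_of_tendsto`). [folklore] -/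
theorem norm_iteratedFDeriv_mul_le (h : D.FarChartsConverge B Φₙ Φ) {m : ℕ} (hm : m ≤ k)
    (x : B.domain) {w C : ℝ}
    (hₙ : ∀ᶠ n in atTop, ContDiffAt ℝ m ((𝓢ₙ (D.sub n)).deviationExtend B (Φₙ (D.sub n))) x)
    (hlim : ContDiffAt ℝ m (𝓢.deviationExtend B Φ) x)
    (hbound : ∀ᶠ n in atTop,
      ‖iteratedFDeriv ℝ m ((𝓢ₙ (D.sub n)).deviationExtend B (Φₙ (D.sub n))) x‖ * w ≤ C) :
    ‖iteratedFDeriv ℝ m (𝓢.deviationExtend B Φ) x‖ * w ≤ C :=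
  le_of_tendsto ((h.tendsto_iteratedFDeriv hm x hₙ hlim).norm.mul_const w) hbound

end FarChartsConverge

/-- With the constant sequence and constant far charts, the far charts converge along `refl`
(both clauses are identities). Non-vacuity of `FarChartsConverge`. [folklore] -/
theorem farChartsConverge_refl (𝓢 : Spacetime.{u} 4) (p : 𝓢.carrier) (k : ℕ)
    (B : ModelBackground) (Φ : B.domain → 𝓢.carrier) :
    (LocalSubconvergence.refl 𝓢 p k).FarChartsConverge B (fun _ ↦ Φ) Φ where
  eventually_embed_comp_eq _ _ _ := Eventually.of_forall fun _ _ _ ↦ rfl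
  tendsto_supCkENorm_deviationExtend K _ _ := by
    have h0 : 𝓢.deviationExtend B Φ - 𝓢.deviationExtend B Φ = 0 :=
      sub_self (𝓢.deviationExtend B Φ)
    show Tendsto (fun _ : ℕ ↦ supCkENorm K k (𝓢.deviationExtend B Φ - 𝓢.deviationExtend B Φ))
      atTop (𝓝 0)
    rw [h0, supCkENorm_zero]
    exact tendsto_const_nhds

end LocalSubconvergence

/-- **Pointed `Cᵏ_loc` subconvergence with eternal far charts**: there is a subconvergence datum
along which the far charts `Φₙ` converge through the embeddings to the far chart `Φ` of the
limit (`LocalSubconvergence.FarChartsConverge`). The interface between the compactness child and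
the limit-structure child of the crux `LaSalleTransfer`. Petersen 2006, Ch. 10, §3.2; Anderson
2004, Def. 1.1 and §5. [cite: Petersen2006, Ch. 10 §3.2] -/
def SubconvergesLocallyWithFarChartsTo (𝓢ₙ : ℕ → Spacetime.{u} 4) (pₙ : ∀ n, (𝓢ₙ n).carrier)
    (𝓢 : Spacetime.{v} 4) (p : 𝓢.carrier) (k : ℕ) (B : ModelBackground)
    (Φₙ : ∀ n, B.domain → (𝓢ₙ n).carrier) (Φ : B.domain → 𝓢.carrier) : Prop :=
  ∃ D : LocalSubconvergence 𝓢ₙ pₙ 𝓢 p k, D.FarChartsConverge B Φₙ Φ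

/-- Subconvergence with far charts forgets to plain subconvergence. [folklore] -/
theorem SubconvergesLocallyWithFarChartsTo.subconvergesLocallyTo {𝓢ₙ : ℕ → Spacetime.{u} 4}
    {pₙ : ∀ n, (𝓢ₙ n).carrier} {𝓢 : Spacetime.{v} 4} {p : 𝓢.carrier} {k : ℕ}
    {B : ModelBackground} {Φₙ : ∀ n, B.domain → (𝓢ₙ n).carrier} {Φ : B.domain → 𝓢.carrier}
    (h : SubconvergesLocallyWithFarChartsTo 𝓢ₙ pₙ 𝓢 p k B Φₙ Φ) :
    SubconvergesLocallyTo 𝓢ₙ pₙ 𝓢 p k :=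
  h.elim fun D _ ↦ ⟨D⟩

/-- The constant sequence with constant far charts subconverges with far charts (non-vacuity).
[folklore] -/
theorem SubconvergesLocallyWithFarChartsTo.refl (𝓢 : Spacetime.{u} 4) (p : 𝓢.carrier) (k : ℕ)
    (B : ModelBackground) (Φ : B.domain → 𝓢.carrier) :
    SubconvergesLocallyWithFarChartsTo (fun _ ↦ 𝓢) (fun _ ↦ p) 𝓢 p k B (fun _ ↦ Φ) Φ :=
  ⟨LocalSubconvergence.refl 𝓢 p k, LocalSubconvergence.farChartsConverge_refl 𝓢 p k B Φ⟩

end Spacetime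

end Literature.Geometry.Lorentzian

end
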